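import Literature.Analysis.OperatorTheory.Enflo2023.Lemma1
import Literature.Analysis.OperatorTheory.Enflo2023.Lemma1Cyclic
import HarnessLib

/-!
# Enflo (2023), Lemma 1 in the manuscript's own quantifier order: the printed choice of `u₁` suffices once `(εθ)₀ ≪ σ₀²`

P. H. Enflo, *On the invariant subspace problem in Hilbert spaces*, arXiv:2305.15442v2, p. 7 (choice of `x₀`, `u₁`,
tex L255–L265) and pp. 8–9 (LEMMA 1) — a CLAIMED result under adjudication; this file adjudicates one inference and
does not endorse the manuscript's theorem.

**The question left open by `Lemma1` … `Lemma1Band`.**  The printed requirement on `u₁` (p. 7: any unit `u₁ ⟂ u₀` with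
`‖T*u₁‖ < (εθ)₀`) is NOT sufficient for the printed Lemma 1 uniformly: for every `(εθ)₀ ∈ (0, 1.72·10⁻¹⁵)` there are
standing-form Type-1 data `(T, u₀, u₁)` on which it fails (`Lemma1.printed_u1_choice_dichotomy`,
`Lemma1.Cyclic.printed_lemma1_fails_cyclic`).  In every one of those models, however, `u₀` (or `T`) is TUNED to
`(εθ)₀`: `u₀` is an approximate eigenvector of `T` with eigen-defect `σ₀ := ‖Tu₀ − ⟨u₀,Tu₀⟩u₀‖` comparable to `(εθ)₀`.
The manuscript's order of choices is different (p. 7, L255–L265): `T` and the Type-1 vector `u₀` are fixed FIRST,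
then "`(εθ)₀` chosen below" (small, p. 8: "of a smaller order of magnitude than the `δ_k`"), then `u₁`.

**What this file proves (kernel-checked, no `sorry`).**
* `Defect.feasible_defect_ineq` — the geometric heart: if `a` is feasible at radius `½ − w` then, with
  `m₁ = ⟨u₁, Tu₀⟩`, `g = Tu₀ − ⟨u₀,Tu₀⟩u₀ − m₁u₁` (the part of `Tu₀` outside `span{u₀,u₁}`) and `η ≥ ‖T*u₁‖`,
  `(w − 0.872‖T‖η‖a‖)·‖g‖ ≤ η·(√((√3/2 + 0.872‖T‖)η‖a‖) + 1.76‖T‖σ₀‖a‖)`.  Ingredients: the `u₁`-coordinate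
  (`Lemma1.inner_u₁_V`, as in `Lemma1.u1_coord_lower_bound`), Bessel's inequality for the pair `(u₁, g)`, and the
  approximate-eigenvector expansion `T^j u₀ = n₀^j u₀ + R_j`, `‖R_j‖ ≤ j‖T‖^{j−1}σ₀` (`Defect.norm_pow_sub_smul_le`),
  which bounds the tail functional `‖V*(T*²g)‖ ≤ 1.76‖T‖σ₀‖g‖` (`Defect.norm_adjoint_V_tail_le`).
* `Defect.exists_minimal_of_forall_lt` — the growth half of the proof of Lemma 1 on its own: if `εθ(ℓ'_ε) > t` for every
  minimiser at every radius of `[½ − 2t, ½]`, then `ℓ'_{½−2t}` exists with `‖ℓ'_{½−2t}‖ ≤ e² < 7.39`.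
* `lemma1_printed_of_defect` — **the printed Lemma 1 HOLDS for every `T` with `‖T‖ ≤ 10⁻²⁰`, every orthonormal
  `u₀, u₁` with the PRINTED requirement `‖T*u₁‖ ≤ (εθ)₀`, and every `0 < (εθ)₀ ≤ 10⁻¹¹·σ₀²`**: some
  `ε ∈ [½ − 10⁻⁵(εθ)₀, ½]` carries a minimiser with `εθ(ℓ'_ε) ≤ ½·10⁻⁵(εθ)₀`.  So in the manuscript's order of
  quantifiers (`T, u₀` first, then `(εθ)₀` small, then `u₁`) the printed choice of `u₁` IS sufficient, with the
  explicit meaning `(εθ)₀ ≤ 10⁻¹¹‖Tu₀ − ⟨u₀,Tu₀⟩u₀‖²` of "small" (if `σ₀ = 0`, `u₀` is an eigenvector of `T` and the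
  invariant-subspace question for `T` is trivial).  `lemma1_printed_forall_u1` packages this over all admissible `u₁`.
* `printed_lemma1_order_dichotomy` — both phenomena on the SAME data: for `T = D_c = diag(10⁻²⁰/(k+1))` and the cyclic
  Type-1 vector `u₀ = ρ` of `Lemma1Cyclic` built at scale `e₁ ∈ (0, 5·10⁻²³]`, the printed Lemma 1 FAILS at
  `(εθ)₀ = e₁` (with the `u₁` of `Lemma1Cyclic`) and HOLDS at every `(εθ)₀ ≤ 6·10⁻¹³e₁²` for every admissible `u₁`.
Consequence for the audit: the slip at (24) / p. 7 is a slip in a UNIFORM reading only; read in the manuscript's own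
order it is repaired by taking `(εθ)₀ ≤ 10⁻¹¹σ₀(T,u₀)²`, with no change to the choice of `u₁`.  (The repaired uniform
rule `‖T*u₁‖ ≤ 1.25·10⁻⁶(εθ)₀` of `Lemma1.lemma1_repaired` remains the statement used downstream.)
Origin: planner-b2b-enflo-1-g14-0 (formaliser 1, gen 14), 2026-08-19.
-/

noncomputable section

open scoped InnerProductSpace ENNReal
open ContinuousLinearMap

namespace Literature.Analysis.OperatorTheory.Enflo2023

namespace Lemma1

open Vy

variable {H : Type*} [NormedAddCommGroup H] [InnerProductSpace ℂ H] [CompleteSpace H]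

namespace Defect

/-! ### Two-frame geometry: removing the `e`-coordinate, Bessel for a pair -/

omit [CompleteSpace H] in
/-- `‖z − ⟨e,z⟩e‖² = ‖z‖² − |⟨e,z⟩|²` for a unit vector `e`. [folklore] -/
lemma norm_sub_inner_smul_sq (e z : H) (he : ‖e‖ = 1) :
    ‖z - ⟪e, z⟫_ℂ • e‖ ^ 2 = ‖z‖ ^ 2 - ‖⟪e, z⟫_ℂ‖ ^ 2 := by
  have h1 : RCLike.re ⟪z, ⟪e, z⟫_ℂ • e⟫_ℂ = ‖⟪e, z⟫_ℂ‖ ^ 2 := by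
    rw [inner_smul_right, ← inner_conj_symm z e, Complex.mul_conj, RCLike.re_to_complex, Complex.ofReal_re,
      Complex.normSq_eq_norm_sq]
  rw [norm_sub_sq (𝕜 := ℂ), h1, norm_smul, he, mul_one]
  ring

omit [CompleteSpace H] in
/-- Bessel's inequality for the pair `(e, f)` with `e` a unit vector and `f ⟂ e` arbitrary:
`|⟨f,z⟩|² ≤ ‖f‖²(‖z‖² − |⟨e,z⟩|²)`. [folklore] -/
lemma norm_inner_sq_le_of_orth (e f z : H) (he : ‖e‖ = 1) (hef : ⟪e, f⟫_ℂ = 0) :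
    ‖⟪f, z⟫_ℂ‖ ^ 2 ≤ ‖f‖ ^ 2 * (‖z‖ ^ 2 - ‖⟪e, z⟫_ℂ‖ ^ 2) := by
  have hfe : ⟪f, e⟫_ℂ = 0 := by rw [← inner_conj_symm, hef, map_zero]
  have h1 : ⟪f, z - ⟪e, z⟫_ℂ • e⟫_ℂ = ⟪f, z⟫_ℂ := by
    rw [inner_sub_right, inner_smul_right, hfe, mul_zero, sub_zero]
  have h2 := norm_inner_le_norm (𝕜 := ℂ) f (z - ⟪e, z⟫_ℂ • e)
  rw [h1] at h2
  calc ‖⟪f, z⟫_ℂ‖ ^ 2 ≤ (‖f‖ * ‖z - ⟪e, z⟫_ℂ • e‖) ^ 2 := pow_le_pow_left₀ (norm_nonneg _) h2 2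
    _ = ‖f‖ ^ 2 * (‖z‖ ^ 2 - ‖⟪e, z⟫_ℂ‖ ^ 2) := by rw [mul_pow, norm_sub_inner_smul_sq e z he]

/-! ### Powers of `T` on an approximate eigenvector -/

omit [CompleteSpace H] in
/-- **Approximate-eigenvector expansion.**  For any scalar `c` with `|c| ≤ ‖T‖`:
`‖T^{k+1}u₀ − c^{k+1}u₀‖ ≤ (k+1)‖T‖^k‖Tu₀ − cu₀‖` (telescoping `T^{k+1}u₀ − c^{k+1}u₀ = Σ_i c^{k−i}T^i(Tu₀ − cu₀)`). [folklore] -/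
lemma norm_pow_sub_smul_le (T : H →L[ℂ] H) (u₀ : H) (c : ℂ) (hc : ‖c‖ ≤ ‖T‖) (k : ℕ) :
    ‖(T ^ (k + 1)) u₀ - c ^ (k + 1) • u₀‖ ≤ ((k : ℝ) + 1) * ‖T‖ ^ k * ‖T u₀ - c • u₀‖ := by
  induction k with
  | zero => simp
  | succ k ih =>
    have hpow : (T ^ (k + 1 + 1)) u₀ = T ((T ^ (k + 1)) u₀) := by rw [pow_succ']; rfl
    have hid : (T ^ (k + 1 + 1)) u₀ - c ^ (k + 1 + 1) • u₀ =
        T ((T ^ (k + 1)) u₀ - c ^ (k + 1) • u₀) + c ^ (k + 1) • (T u₀ - c • u₀) := by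
      rw [hpow, map_sub, map_smul, smul_sub, smul_smul, ← pow_succ]
      abel
    rw [hid]
    have h1 : ‖T ((T ^ (k + 1)) u₀ - c ^ (k + 1) • u₀)‖ ≤ ‖T‖ * (((k : ℝ) + 1) * ‖T‖ ^ k * ‖T u₀ - c • u₀‖) :=
      (T.le_opNorm _).trans (mul_le_mul_of_nonneg_left ih (norm_nonneg _))
    have h2 : ‖c ^ (k + 1) • (T u₀ - c • u₀)‖ ≤ ‖T‖ ^ (k + 1) * ‖T u₀ - c • u₀‖ := by
      rw [norm_smul, norm_pow]
      exact mul_le_mul_of_nonneg_right (pow_le_pow_left₀ (norm_nonneg _) hc _) (norm_nonneg _)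
    calc ‖T ((T ^ (k + 1)) u₀ - c ^ (k + 1) • u₀) + c ^ (k + 1) • (T u₀ - c • u₀)‖
        ≤ ‖T ((T ^ (k + 1)) u₀ - c ^ (k + 1) • u₀)‖ + ‖c ^ (k + 1) • (T u₀ - c • u₀)‖ := norm_add_le _ _
      _ ≤ ‖T‖ * (((k : ℝ) + 1) * ‖T‖ ^ k * ‖T u₀ - c • u₀‖) + ‖T‖ ^ (k + 1) * ‖T u₀ - c • u₀‖ :=
          add_le_add h1 h2
      _ = ((↑(k + 1) : ℝ) + 1) * ‖T‖ ^ (k + 1) * ‖T u₀ - c • u₀‖ := by push_cast; ring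

omit [CompleteSpace H] in
/-- Pairing with a vector `h ⟂ u₀` kills the main term: `|⟨h, T^{k+1}u₀⟩| ≤ ‖h‖(k+1)‖T‖^k‖Tu₀ − cu₀‖`. [folklore] -/
lemma norm_inner_pow_apply_le (T : H →L[ℂ] H) (u₀ h : H) (c : ℂ) (hc : ‖c‖ ≤ ‖T‖) (hh : ⟪h, u₀⟫_ℂ = 0)
    (k : ℕ) : ‖⟪h, (T ^ (k + 1)) u₀⟫_ℂ‖ ≤ ‖h‖ * (((k : ℝ) + 1) * ‖T‖ ^ k * ‖T u₀ - c • u₀‖) := by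
  have h1 : ⟪h, (T ^ (k + 1)) u₀⟫_ℂ = ⟪h, (T ^ (k + 1)) u₀ - c ^ (k + 1) • u₀⟫_ℂ := by
    rw [inner_sub_right, inner_smul_right, hh, mul_zero, sub_zero]
  rw [h1]
  exact (norm_inner_le_norm _ _).trans
    (mul_le_mul_of_nonneg_left (norm_pow_sub_smul_le T u₀ c hc k) (norm_nonneg _))

/-- `(j+2)² ≤ 4·3^j`. [folklore] -/
lemma sq_add_two_le (j : ℕ) : ((j : ℝ) + 2) ^ 2 ≤ 4 * 3 ^ j := by
  induction j with
  | zero => norm_num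
  | succ j ih =>
    have hj : (0 : ℝ) ≤ j := Nat.cast_nonneg j
    have h3 : (3 : ℝ) ^ (j + 1) = 3 ^ j * 3 := pow_succ 3 j
    push_cast
    rw [h3]
    nlinarith [ih, hj, mul_nonneg hj hj]

/-- **The tail functional.**  For `h ⟂ u₀` and `y₀' = (√3/2)u₀`, the ℓ²-vector `V_{y₀'}*(T*T*h)` has coordinates
`(√3/2)⟨T^{j+2}u₀, h⟩`, each `≤ (√3/2)(j+2)‖T‖^{j+1}σ‖h‖` in modulus (`σ = ‖Tu₀ − cu₀‖`, `|c| ≤ ‖T‖`); hence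
`‖V_{y₀'}*(T*T*h)‖ ≤ 1.76‖T‖σ‖h‖` for `‖T‖ ≤ 1/10`.  This is what replaces the crude `‖T²‖ ≤ ‖T‖²` for an approximate
eigenvector `u₀`. [cite: Enflo2023, v2 p.2 eq. (2)–(4), p.9 l.7–12] -/
lemma norm_adjoint_V_tail_le (T : H →L[ℂ] H) (hT : ‖T‖ < 1) (hT10 : ‖T‖ ≤ 1 / 10) (u₀ h : H) (c : ℂ)
    (hc : ‖c‖ ≤ ‖T‖) (hh : ⟪h, u₀⟫_ℂ = 0) :
    ‖adjoint (V T hT (yStart u₀)) (adjoint T (adjoint T h))‖ ≤ 1.76 * ‖T‖ * ‖T u₀ - c • u₀‖ * ‖h‖ := by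
  obtain ⟨b, hb⟩ : ∃ b : ℓ2, b = adjoint (V T hT (yStart u₀)) (adjoint T (adjoint T h)) := ⟨_, rfl⟩
  rw [← hb]
  have hq0 : 0 ≤ ‖T‖ := norm_nonneg _
  have hq2 : ‖T‖ ^ 2 ≤ 1 / 100 := by nlinarith [hq0, hT10]
  have hc0sq : (Real.sqrt 3 / 2) ^ 2 = 3 / 4 := by rw [div_pow, Real.sq_sqrt (by norm_num)]; norm_num
  -- coordinates of `b`
  have hcoord : ∀ j : ℕ, b j = ((Real.sqrt 3 / 2 : ℝ) : ℂ) * ⟪(T ^ (j + 1 + 1)) u₀, h⟫_ℂ := by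
    intro j
    have hp : (T ^ (j + 1 + 1)) u₀ = T (T ((T ^ j) u₀)) := by rw [pow_succ', pow_succ']; rfl
    rw [hb, adjoint_V_coord, adjoint_inner_right, adjoint_inner_right, yStart, map_smul, map_smul, map_smul,
      inner_smul_left, Complex.conj_ofReal, hp]
  have hterm : ∀ j : ℕ, ‖b j‖ ^ 2 ≤ 3 * ‖h‖ ^ 2 * ‖T u₀ - c • u₀‖ ^ 2 * ‖T‖ ^ 2 * (3 * ‖T‖ ^ 2) ^ j := by
    intro j
    have hM : ‖b j‖ ≤ Real.sqrt 3 / 2 * (‖h‖ * (((↑(j + 1) : ℝ) + 1) * ‖T‖ ^ (j + 1) * ‖T u₀ - c • u₀‖)) := by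
      rw [hcoord j, norm_mul, Complex.norm_real, Real.norm_of_nonneg (by positivity), norm_inner_symm]
      exact mul_le_mul_of_nonneg_left (norm_inner_pow_apply_le T u₀ h c hc hh (j + 1)) (by positivity)
    have h4 := sq_add_two_le j
    have hnn : 0 ≤ ‖h‖ ^ 2 * ‖T u₀ - c • u₀‖ ^ 2 * ‖T‖ ^ 2 * (‖T‖ ^ 2) ^ j := by positivity
    calc ‖b j‖ ^ 2 ≤ (Real.sqrt 3 / 2 * (‖h‖ * (((↑(j + 1) : ℝ) + 1) * ‖T‖ ^ (j + 1) * ‖T u₀ - c • u₀‖))) ^ 2 :=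
          pow_le_pow_left₀ (norm_nonneg _) hM 2
      _ = 3 / 4 * (‖h‖ ^ 2 * ‖T u₀ - c • u₀‖ ^ 2 * ‖T‖ ^ 2 * (‖T‖ ^ 2) ^ j) * ((j : ℝ) + 2) ^ 2 := by
          rw [mul_pow, hc0sq]; push_cast; ring
      _ ≤ 3 / 4 * (‖h‖ ^ 2 * ‖T u₀ - c • u₀‖ ^ 2 * ‖T‖ ^ 2 * (‖T‖ ^ 2) ^ j) * (4 * 3 ^ j) :=
          mul_le_mul_of_nonneg_left h4 (by positivity)
      _ = 3 * ‖h‖ ^ 2 * ‖T u₀ - c • u₀‖ ^ 2 * ‖T‖ ^ 2 * (3 * ‖T‖ ^ 2) ^ j := by rw [mul_pow]; ring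
  -- sum the geometric majorant
  have hr0 : 0 ≤ 3 * ‖T‖ ^ 2 := by positivity
  have hr1 : 3 * ‖T‖ ^ 2 < 1 := by linarith
  have hpos : 0 < 1 - 3 * ‖T‖ ^ 2 := by linarith
  have hgeo := summable_geometric_of_lt_one hr0 hr1
  have hsum : ‖b‖ ^ 2 ≤ 3 * ‖h‖ ^ 2 * ‖T u₀ - c • u₀‖ ^ 2 * ‖T‖ ^ 2 * (1 - 3 * ‖T‖ ^ 2)⁻¹ := by
    rw [norm_sq_eq_tsum b, ← tsum_geometric_of_lt_one hr0 hr1, ← tsum_mul_left]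
    exact Summable.tsum_le_tsum hterm (summable_sq b) (hgeo.mul_left _)
  have hden : (1 - 3 * ‖T‖ ^ 2)⁻¹ ≤ 1.032 := by
    rw [inv_eq_one_div, div_le_iff₀ hpos]; nlinarith
  have hsq : ‖b‖ ^ 2 ≤ (1.76 * ‖T‖ * ‖T u₀ - c • u₀‖ * ‖h‖) ^ 2 := by
    have hC : 0 ≤ 3 * ‖h‖ ^ 2 * ‖T u₀ - c • u₀‖ ^ 2 * ‖T‖ ^ 2 := by positivity
    have h1 := mul_le_mul_of_nonneg_left hden hC
    nlinarith [hsum, h1, hC]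
  exact le_of_pow_le_pow_left₀ two_ne_zero (by positivity) hsq

/-! ### The part of `Tu₀` outside `span{u₀, u₁}` -/

omit [CompleteSpace H] in
/-- `‖g‖² = σ₀² − |m₁|²` for `g = Tu₀ − ⟨u₀,Tu₀⟩u₀ − ⟨u₁,Tu₀⟩u₁`, `σ₀ = ‖Tu₀ − ⟨u₀,Tu₀⟩u₀‖`, `m₁ = ⟨u₁,Tu₀⟩`
(Pythagoras in `u₀^⊥`). [folklore] -/
lemma norm_sq_garbage (T : H →L[ℂ] H) (u₀ u₁ : H) (hu₁ : ‖u₁‖ = 1) (h01 : ⟪u₀, u₁⟫_ℂ = 0) :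
    ‖T u₀ - ⟪u₀, T u₀⟫_ℂ • u₀ - ⟪u₁, T u₀⟫_ℂ • u₁‖ ^ 2 =
      ‖T u₀ - ⟪u₀, T u₀⟫_ℂ • u₀‖ ^ 2 - ‖⟪u₁, T u₀⟫_ℂ‖ ^ 2 := by
  have h10 : ⟪u₁, u₀⟫_ℂ = 0 := by rw [← inner_conj_symm, h01, map_zero]
  have hm : ⟪u₁, T u₀ - ⟪u₀, T u₀⟫_ℂ • u₀⟫_ℂ = ⟪u₁, T u₀⟫_ℂ := by
    rw [inner_sub_right, inner_smul_right, h10, mul_zero, sub_zero]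
  have h := norm_sub_inner_smul_sq u₁ (T u₀ - ⟪u₀, T u₀⟫_ℂ • u₀) hu₁
  rw [hm] at h
  exact h

omit [CompleteSpace H] in
/-- The eigen-defect is at most `‖Tu₀‖ ≤ ‖T‖`: `‖Tu₀ − ⟨u₀,Tu₀⟩u₀‖ ≤ ‖T‖` for a unit vector `u₀`. [folklore] -/
lemma defect_le_opNorm (T : H →L[ℂ] H) (u₀ : H) (hu₀ : ‖u₀‖ = 1) :
    ‖T u₀ - ⟪u₀, T u₀⟫_ℂ • u₀‖ ≤ ‖T‖ := by
  have h := norm_sub_inner_smul_sq u₀ (T u₀) hu₀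
  have h1 : ‖T u₀‖ ≤ ‖T‖ := by have := T.le_opNorm u₀; rwa [hu₀, mul_one] at this
  have h2 : ‖T u₀ - ⟪u₀, T u₀⟫_ℂ • u₀‖ ^ 2 ≤ ‖T‖ ^ 2 := by
    rw [h]; nlinarith [sq_nonneg ‖⟪u₀, T u₀⟫_ℂ‖, norm_nonneg (T u₀), norm_nonneg T]
  exact le_of_pow_le_pow_left₀ two_ne_zero (norm_nonneg _) h2

omit [CompleteSpace H] in
/-- The part `g = Tu₀ − ⟨u₀,Tu₀⟩u₀ − ⟨u₁,Tu₀⟩u₁` of `Tu₀` outside `span{u₀,u₁}` (`u₀ ⟂ u₁` unit vectors):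
`g ⟂ u₀`, `g ⟂ u₁`, `⟨g, Tu₀⟩ = ‖g‖²`. [folklore] -/
lemma garbage_orth (T : H →L[ℂ] H) (u₀ u₁ : H) (hu₀ : ‖u₀‖ = 1) (hu₁ : ‖u₁‖ = 1) (h01 : ⟪u₀, u₁⟫_ℂ = 0) :
    ⟪T u₀ - ⟪u₀, T u₀⟫_ℂ • u₀ - ⟪u₁, T u₀⟫_ℂ • u₁, u₀⟫_ℂ = 0 ∧
    ⟪T u₀ - ⟪u₀, T u₀⟫_ℂ • u₀ - ⟪u₁, T u₀⟫_ℂ • u₁, u₁⟫_ℂ = 0 ∧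
    ⟪T u₀ - ⟪u₀, T u₀⟫_ℂ • u₀ - ⟪u₁, T u₀⟫_ℂ • u₁, T u₀⟫_ℂ =
      ((‖T u₀ - ⟪u₀, T u₀⟫_ℂ • u₀ - ⟪u₁, T u₀⟫_ℂ • u₁‖ ^ 2 : ℝ) : ℂ) := by
  obtain ⟨g, hg⟩ : ∃ g : H, g = T u₀ - ⟪u₀, T u₀⟫_ℂ • u₀ - ⟪u₁, T u₀⟫_ℂ • u₁ := ⟨_, rfl⟩
  rw [← hg]
  have h10 : ⟪u₁, u₀⟫_ℂ = 0 := by rw [← inner_conj_symm, h01, map_zero]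
  have h00 : ⟪u₀, u₀⟫_ℂ = 1 := by rw [inner_self_eq_norm_sq_to_K, hu₀]; norm_num
  have h11 : ⟪u₁, u₁⟫_ℂ = 1 := by rw [inner_self_eq_norm_sq_to_K, hu₁]; norm_num
  have hgu₀ : ⟪g, u₀⟫_ℂ = 0 := by
    rw [hg, inner_sub_left, inner_sub_left, inner_smul_left, inner_smul_left, h00, h10,
      ← inner_conj_symm (T u₀) u₀]
    ring
  have hgu₁ : ⟪g, u₁⟫_ℂ = 0 := by
    rw [hg, inner_sub_left, inner_sub_left, inner_smul_left, inner_smul_left, h01, h11,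
      ← inner_conj_symm (T u₀) u₁]
    ring
  refine ⟨hgu₀, hgu₁, ?_⟩
  have hTu : T u₀ = g + ⟪u₀, T u₀⟫_ℂ • u₀ + ⟪u₁, T u₀⟫_ℂ • u₁ := by rw [hg]; abel
  have h1 : ⟪g, T u₀⟫_ℂ = ⟪g, g + ⟪u₀, T u₀⟫_ℂ • u₀ + ⟪u₁, T u₀⟫_ℂ • u₁⟫_ℂ := by rw [← hTu]
  rw [h1, inner_add_right, inner_add_right, inner_smul_right, inner_smul_right, hgu₀, hgu₁, mul_zero,
    mul_zero, add_zero, add_zero, inner_self_eq_norm_sq_to_K]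
  norm_cast

/-! ### The geometric heart: feasibility near radius `½` against the eigen-defect of `u₀` -/

/-- `‖V_{y₀'} b‖ ≤ 0.872‖b‖` for `y₀' = (√3/2)u₀`, `‖T‖ ≤ 1/10`. [cite: Enflo2023, v2 p.2, eq. (2)] -/
lemma norm_V_yStart_apply_le (T : H →L[ℂ] H) (hT : ‖T‖ < 1) (hT10 : ‖T‖ ≤ 1 / 10) (u₀ : H)
    (hu₀ : ‖u₀‖ = 1) (b : ℓ2) : ‖V T hT (yStart u₀) b‖ ≤ 0.872 * ‖b‖ := by
  calc ‖V T hT (yStart u₀) b‖ ≤ ‖V T hT (yStart u₀)‖ * ‖b‖ := le_opNorm _ _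
    _ ≤ (Real.sqrt 3 / 2 * Real.sqrt (1 / (1 - ‖T‖ ^ 2))) * ‖b‖ := by
        have hV := norm_V_le T hT (yStart u₀)
        rw [norm_yStart u₀ hu₀] at hV
        exact mul_le_mul_of_nonneg_right hV (norm_nonneg _)
    _ ≤ 0.872 * ‖b‖ := mul_le_mul_of_nonneg_right (opNorm_factor_le T hT10) (norm_nonneg _)

/-- (i) **The `u₁`-coordinate, two steps deep** (v2 p.9 l.7–12): `⟨u₁, V a⟩ = a₁(√3/2)⟨u₁,Tu₀⟩ + ⟨T*²u₁, V(L²a)⟩`,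
hence `|⟨u₁, V a⟩| ≤ (√3/2)|a₁||⟨u₁,Tu₀⟩| + 0.872‖T‖‖T*u₁‖‖a‖` — the coefficient of `a₁` is the LEVER
`m₁ = ⟨u₁,Tu₀⟩`, bounded by `‖T*u₁‖` but possibly much smaller. [cite: Enflo2023, v2 p.9, l.7–12] -/
lemma norm_inner_u₁_V_le (T : H →L[ℂ] H) (hT : ‖T‖ < 1) (hT10 : ‖T‖ ≤ 1 / 10) (u₀ u₁ : H)
    (hu₀ : ‖u₀‖ = 1) (h01 : ⟪u₀, u₁⟫_ℂ = 0) (a : ℓ2) :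
    ‖⟪u₁, V T hT (yStart u₀) a⟫_ℂ‖ ≤
      Real.sqrt 3 / 2 * ‖a 1‖ * ‖⟪u₁, T u₀⟫_ℂ‖ + 0.872 * ‖T‖ * ‖adjoint T u₁‖ * ‖a‖ := by
  have hc₀ : 0 ≤ Real.sqrt 3 / 2 := by positivity
  have hVLa : V T hT (yStart u₀) (L a) = a 1 • yStart u₀ + T (V T hT (yStart u₀) (L (L a))) := by
    have h := V_decomp T hT (yStart u₀) (L a)
    simpa only [L_apply, zero_add] using h
  have hTy : ⟪adjoint T u₁, yStart u₀⟫_ℂ = ((Real.sqrt 3 / 2 : ℝ) : ℂ) * ⟪u₁, T u₀⟫_ℂ := by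
    rw [yStart, inner_smul_right, adjoint_inner_left]
  have hs_eq : ⟪u₁, V T hT (yStart u₀) a⟫_ℂ = a 1 * (((Real.sqrt 3 / 2 : ℝ) : ℂ) * ⟪u₁, T u₀⟫_ℂ) +
      ⟪adjoint T (adjoint T u₁), V T hT (yStart u₀) (L (L a))⟫_ℂ := by
    rw [inner_u₁_V T hT u₀ u₁ h01 a, hVLa, inner_add_right, inner_smul_right, hTy,
      ← adjoint_inner_left T (V T hT (yStart u₀) (L (L a))) (adjoint T u₁)]
  have hTT : ‖adjoint T (adjoint T u₁)‖ ≤ ‖T‖ * ‖adjoint T u₁‖ := by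
    have h := (adjoint T).le_opNorm (adjoint T u₁)
    rwa [ContinuousLinearMap.adjoint.norm_map T] at h
  have hLL : ‖L (L a)‖ ≤ ‖a‖ := (norm_L_apply_le _).trans (norm_L_apply_le a)
  have h1 : ‖(a 1 : ℂ) * (((Real.sqrt 3 / 2 : ℝ) : ℂ) * ⟪u₁, T u₀⟫_ℂ)‖ =
      Real.sqrt 3 / 2 * ‖a 1‖ * ‖⟪u₁, T u₀⟫_ℂ‖ := by
    rw [norm_mul, norm_mul, Complex.norm_real, Real.norm_of_nonneg hc₀]; ring
  have h2 : ‖⟪adjoint T (adjoint T u₁), V T hT (yStart u₀) (L (L a))⟫_ℂ‖ ≤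
      0.872 * ‖T‖ * ‖adjoint T u₁‖ * ‖a‖ := by
    calc ‖⟪adjoint T (adjoint T u₁), V T hT (yStart u₀) (L (L a))⟫_ℂ‖
        ≤ ‖adjoint T (adjoint T u₁)‖ * ‖V T hT (yStart u₀) (L (L a))‖ := norm_inner_le_norm _ _
      _ ≤ (‖T‖ * ‖adjoint T u₁‖) * (0.872 * ‖a‖) :=
          mul_le_mul hTT ((norm_V_yStart_apply_le T hT hT10 u₀ hu₀ _).trans
            (mul_le_mul_of_nonneg_left hLL (by norm_num))) (norm_nonneg _) (by positivity)
      _ = 0.872 * ‖T‖ * ‖adjoint T u₁‖ * ‖a‖ := by ring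
  rw [hs_eq]
  calc _ ≤ ‖(a 1 : ℂ) * (((Real.sqrt 3 / 2 : ℝ) : ℂ) * ⟪u₁, T u₀⟫_ℂ)‖ +
        ‖⟪adjoint T (adjoint T u₁), V T hT (yStart u₀) (L (L a))⟫_ℂ‖ := norm_add_le _ _
    _ ≤ _ := by rw [h1]; exact add_le_add le_rfl h2

/-- (ii) **Bessel for the pair `(u₁, f)`** at `z = x₀ − V a` with `‖z‖ ≤ ½ − w`, `0 ≤ w ≤ 1`, `f ⟂ u₁`: since the
`u₁`-coordinate of `z` is `½ − s`, `s = ⟨u₁, V a⟩`, one gets `|⟨f, z⟩|² ≤ ‖f‖²(‖z‖² − |½ − s|²) ≤ ‖f‖²|s|`.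
[cite: Enflo2023, v2 p.9, l.7–12] -/
lemma norm_inner_residual_le (T : H →L[ℂ] H) (hT : ‖T‖ < 1) (u₀ u₁ : H) (hu₁ : ‖u₁‖ = 1)
    (h01 : ⟪u₀, u₁⟫_ℂ = 0) (a : ℓ2) {w : ℝ} (hw0 : 0 ≤ w) (hw1 : w ≤ 1)
    (hfe : ‖xStart u₀ u₁ - V T hT (yStart u₀) a‖ ≤ 1 / 2 - w) (f : H) (hf : ⟪u₁, f⟫_ℂ = 0) :
    ‖⟪f, xStart u₀ u₁ - V T hT (yStart u₀) a⟫_ℂ‖ ≤ ‖f‖ * Real.sqrt ‖⟪u₁, V T hT (yStart u₀) a⟫_ℂ‖ := by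
  obtain ⟨s, hs⟩ : ∃ s : ℂ, s = ⟪u₁, V T hT (yStart u₀) a⟫_ℂ := ⟨_, rfl⟩
  rw [← hs]
  have hzu₁ : ⟪u₁, xStart u₀ u₁ - V T hT (yStart u₀) a⟫_ℂ = (1 / 2 : ℂ) - s := by
    rw [hs, inner_sub_right, inner_u₁_xStart u₀ u₁ hu₁ h01]
  have h1 := norm_inner_sq_le_of_orth u₁ f (xStart u₀ u₁ - V T hT (yStart u₀) a) hu₁ hf
  rw [hzu₁] at h1
  have hd : 1 / 2 - ‖s‖ ≤ ‖(1 / 2 : ℂ) - s‖ := by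
    have h3 := norm_sub_norm_le (1 / 2 : ℂ) s
    have h12 : ‖(1 / 2 : ℂ)‖ = 1 / 2 := by norm_num
    linarith
  have hz2 : ‖xStart u₀ u₁ - V T hT (yStart u₀) a‖ ^ 2 ≤ (1 / 2 - w) ^ 2 :=
    pow_le_pow_left₀ (norm_nonneg _) hfe 2
  have hww : 0 ≤ w * (1 - w) := mul_nonneg hw0 (by linarith)
  have hreal : ‖xStart u₀ u₁ - V T hT (yStart u₀) a‖ ^ 2 - ‖(1 / 2 : ℂ) - s‖ ^ 2 ≤ ‖s‖ := by
    rcases le_or_gt ‖s‖ (1 / 2) with hsm | hsm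
    · have hd0 : 0 ≤ 1 / 2 - ‖s‖ := by linarith
      have hd2 : (1 / 2 - ‖s‖) ^ 2 ≤ ‖(1 / 2 : ℂ) - s‖ ^ 2 := pow_le_pow_left₀ hd0 hd 2
      nlinarith [norm_nonneg s, hd2, hz2, hww]
    · nlinarith [sq_nonneg ‖(1 / 2 : ℂ) - s‖, hz2, hww, hsm]
  have hb : ‖⟪f, xStart u₀ u₁ - V T hT (yStart u₀) a⟫_ℂ‖ ^ 2 ≤ ‖f‖ ^ 2 * ‖s‖ :=
    h1.trans (mul_le_mul_of_nonneg_left hreal (sq_nonneg _))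
  have h := Real.sqrt_le_sqrt hb
  rwa [Real.sqrt_sq (norm_nonneg _), Real.sqrt_mul (sq_nonneg _), Real.sqrt_sq (norm_nonneg _)] at h

/-- **`⟨g, x₀ − V a⟩ = −(a₁(√3/2)‖g‖² + ⟨V*(T*T*g), L²a⟩)`** for the part `g` of `Tu₀` outside `span{u₀,u₁}`:
`g ⟂ x₀, y₀'`, and in `V a = a₀y₀' + T(a₁y₀' + T V(L²a))` only `a₁⟨g, Ty₀'⟩ = a₁(√3/2)‖g‖²` and the doubly
shifted tail survive. [cite: Enflo2023, v2 p.9, l.7–12] -/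
lemma inner_garbage_residual (T : H →L[ℂ] H) (hT : ‖T‖ < 1) (u₀ u₁ : H) (hu₀ : ‖u₀‖ = 1) (hu₁ : ‖u₁‖ = 1)
    (h01 : ⟪u₀, u₁⟫_ℂ = 0) (a : ℓ2) :
    ⟪T u₀ - ⟪u₀, T u₀⟫_ℂ • u₀ - ⟪u₁, T u₀⟫_ℂ • u₁, xStart u₀ u₁ - V T hT (yStart u₀) a⟫_ℂ =
      -((a 1 : ℂ) * (((Real.sqrt 3 / 2 : ℝ) : ℂ) *
          ((‖T u₀ - ⟪u₀, T u₀⟫_ℂ • u₀ - ⟪u₁, T u₀⟫_ℂ • u₁‖ ^ 2 : ℝ) : ℂ)) +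
        ⟪adjoint (V T hT (yStart u₀))
          (adjoint T (adjoint T (T u₀ - ⟪u₀, T u₀⟫_ℂ • u₀ - ⟪u₁, T u₀⟫_ℂ • u₁))), L (L a)⟫_ℂ) := by
  obtain ⟨hgu₀, hgu₁, hgT⟩ := garbage_orth T u₀ u₁ hu₀ hu₁ h01
  obtain ⟨g, hg⟩ : ∃ g : H, g = T u₀ - ⟪u₀, T u₀⟫_ℂ • u₀ - ⟪u₁, T u₀⟫_ℂ • u₁ := ⟨_, rfl⟩
  rw [← hg] at hgu₀ hgu₁ hgT ⊢
  have hgy : ⟪g, yStart u₀⟫_ℂ = 0 := by rw [yStart, inner_smul_right, hgu₀, mul_zero]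
  have hgx : ⟪g, xStart u₀ u₁⟫_ℂ = 0 := by
    rw [xStart, inner_add_right, inner_smul_right, inner_smul_right, hgu₀, hgu₁, mul_zero, mul_zero, add_zero]
  have hVLa : V T hT (yStart u₀) (L a) = a 1 • yStart u₀ + T (V T hT (yStart u₀) (L (L a))) := by
    have h := V_decomp T hT (yStart u₀) (L a)
    simpa only [L_apply, zero_add] using h
  have hVa : V T hT (yStart u₀) a =
      a 0 • yStart u₀ + T (a 1 • yStart u₀ + T (V T hT (yStart u₀) (L (L a)))) := by
    rw [← hVLa]; exact V_decomp T hT (yStart u₀) a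
  have hTg_y : ⟪adjoint T g, yStart u₀⟫_ℂ = ((Real.sqrt 3 / 2 : ℝ) : ℂ) * ⟪g, T u₀⟫_ℂ := by
    rw [yStart, inner_smul_right, adjoint_inner_left]
  rw [inner_sub_right, hgx, zero_sub, hVa, inner_add_right, inner_smul_right, hgy, mul_zero, zero_add,
    ← adjoint_inner_left T _ g, inner_add_right, inner_smul_right, hTg_y, hgT,
    ← adjoint_inner_left T _ (adjoint T g),
    ← adjoint_inner_left (V T hT (yStart u₀)) (L (L a)) (adjoint T (adjoint T g))]

/-- **Feasibility near radius `½` against the eigen-defect** (v2 p.9 l.7–12 made two-dimensional).  Let `u₀ ⟂ u₁` be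
unit vectors, `x₀ = (√3/2)u₀ + ½u₁`, `y₀' = (√3/2)u₀`, `‖T‖ ≤ 1/10`, `‖T*u₁‖ ≤ η`, and let `a` be feasible at radius
`½ − w` (`0 ≤ w ≤ 1`).  Write `n₀ = ⟨u₀,Tu₀⟩`, `m₁ = ⟨u₁,Tu₀⟩` (so `|m₁| ≤ η`), `σ₀ = ‖Tu₀ − n₀u₀‖`,
`g = Tu₀ − n₀u₀ − m₁u₁`.  Then `(w − 0.872‖T‖η‖a‖)·‖g‖ ≤ η(√((√3/2 + 0.872‖T‖)η‖a‖) + 1.76‖T‖σ₀‖a‖)`.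
Proof: (i) `w ≤ |⟨u₁,V a⟩| ≤ (√3/2)|a₁||m₁| + 0.872‖T‖η‖a‖` (`norm_inner_u₁_V_le`); (ii)
`|⟨g, x₀ − V a⟩| ≤ ‖g‖√|⟨u₁, V a⟩|` (`norm_inner_residual_le`) while `⟨g, x₀ − V a⟩ = −(a₁(√3/2)‖g‖² + tail)`
(`inner_garbage_residual`) with `|tail| ≤ 1.76‖T‖σ₀‖g‖‖a‖` (`norm_adjoint_V_tail_le`); (iii) eliminate `|a₁|`.
[cite: Enflo2023, v2 p.7 (choice of x₀, u₁), p.9 l.7–12] -/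
theorem feasible_defect_ineq (T : H →L[ℂ] H) (hT : ‖T‖ < 1) (hT10 : ‖T‖ ≤ 1 / 10) (u₀ u₁ : H)
    (hu₀ : ‖u₀‖ = 1) (hu₁ : ‖u₁‖ = 1) (h01 : ⟪u₀, u₁⟫_ℂ = 0) (a : ℓ2) {w η : ℝ} (hw0 : 0 ≤ w) (hw1 : w ≤ 1)
    (hη : ‖adjoint T u₁‖ ≤ η) (hfe : ‖xStart u₀ u₁ - V T hT (yStart u₀) a‖ ≤ 1 / 2 - w) :
    (w - 0.872 * ‖T‖ * η * ‖a‖) * ‖T u₀ - ⟪u₀, T u₀⟫_ℂ • u₀ - ⟪u₁, T u₀⟫_ℂ • u₁‖ ≤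
      η * (Real.sqrt ((Real.sqrt 3 / 2 + 0.872 * ‖T‖) * η * ‖a‖) +
        1.76 * ‖T‖ * ‖T u₀ - ⟪u₀, T u₀⟫_ℂ • u₀‖ * ‖a‖) := by
  obtain ⟨hgu₀, hgu₁, -⟩ := garbage_orth T u₀ u₁ hu₀ hu₁ h01
  have hgz := inner_garbage_residual T hT u₀ u₁ hu₀ hu₁ h01 a
  obtain ⟨g, hg⟩ : ∃ g : H, g = T u₀ - ⟪u₀, T u₀⟫_ℂ • u₀ - ⟪u₁, T u₀⟫_ℂ • u₁ := ⟨_, rfl⟩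
  rw [← hg] at hgu₀ hgu₁ hgz ⊢
  obtain ⟨s, hs⟩ : ∃ s : ℂ, s = ⟪u₁, V T hT (yStart u₀) a⟫_ℂ := ⟨_, rfl⟩
  have hc₀ : 0 < Real.sqrt 3 / 2 := by positivity
  have hq0 : 0 ≤ ‖T‖ := norm_nonneg _
  have hη0 : 0 ≤ η := (norm_nonneg _).trans hη
  have hg0 : 0 ≤ ‖g‖ := norm_nonneg _
  have hA0 : 0 ≤ ‖a‖ := norm_nonneg _
  have hn₀q : ‖⟪u₀, T u₀⟫_ℂ‖ ≤ ‖T‖ := by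
    calc ‖⟪u₀, T u₀⟫_ℂ‖ ≤ ‖u₀‖ * ‖T u₀‖ := norm_inner_le_norm _ _
      _ ≤ ‖u₀‖ * (‖T‖ * ‖u₀‖) := by gcongr; exact T.le_opNorm u₀
      _ = ‖T‖ := by rw [hu₀]; ring
  have hm₁η : ‖⟪u₁, T u₀⟫_ℂ‖ ≤ η := by
    calc ‖⟪u₁, T u₀⟫_ℂ‖ = ‖⟪adjoint T u₁, u₀⟫_ℂ‖ := by rw [adjoint_inner_left]
      _ ≤ ‖adjoint T u₁‖ * ‖u₀‖ := norm_inner_le_norm _ _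
      _ ≤ η := by rw [hu₀, mul_one]; exact hη
  have hu₁g : ⟪u₁, g⟫_ℂ = 0 := by rw [← inner_conj_symm, hgu₁, map_zero]
  have ha1 : ‖a 1‖ ≤ ‖a‖ := lp.norm_apply_le_norm (by norm_num) a 1
  have hLL : ‖L (L a)‖ ≤ ‖a‖ := (norm_L_apply_le _).trans (norm_L_apply_le a)
  -- (i) the `u₁`-coordinate
  have hws : w ≤ ‖s‖ := by
    have h1 : ⟪u₁, xStart u₀ u₁ - V T hT (yStart u₀) a⟫_ℂ = (1 / 2 : ℂ) - s := by
      rw [hs, inner_sub_right, inner_u₁_xStart u₀ u₁ hu₁ h01]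
    have h2 : ‖(1 / 2 : ℂ) - s‖ ≤ 1 / 2 - w := by
      rw [← h1]
      calc ‖⟪u₁, xStart u₀ u₁ - V T hT (yStart u₀) a⟫_ℂ‖
          ≤ ‖u₁‖ * ‖xStart u₀ u₁ - V T hT (yStart u₀) a‖ := norm_inner_le_norm _ _
        _ ≤ 1 / 2 - w := by rw [hu₁, one_mul]; exact hfe
    exact window_forces_tail h2
  have hs_le : ‖s‖ ≤ Real.sqrt 3 / 2 * ‖a 1‖ * ‖⟪u₁, T u₀⟫_ℂ‖ + 0.872 * ‖T‖ * η * ‖a‖ := by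
    have h := norm_inner_u₁_V_le T hT hT10 u₀ u₁ hu₀ h01 a
    rw [← hs] at h
    have h2 : 0.872 * ‖T‖ * ‖adjoint T u₁‖ * ‖a‖ ≤ 0.872 * ‖T‖ * η * ‖a‖ :=
      mul_le_mul_of_nonneg_right (mul_le_mul_of_nonneg_left hη (by positivity)) hA0
    linarith only [h, h2]
  -- (ii) Bessel and the tail functional
  have hgz_le : ‖⟪g, xStart u₀ u₁ - V T hT (yStart u₀) a⟫_ℂ‖ ≤ ‖g‖ * Real.sqrt ‖s‖ := by
    rw [hs]; exact norm_inner_residual_le T hT u₀ u₁ hu₁ h01 a hw0 hw1 hfe g hu₁g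
  have htail : ‖⟪adjoint (V T hT (yStart u₀)) (adjoint T (adjoint T g)), L (L a)⟫_ℂ‖ ≤
      1.76 * ‖T‖ * ‖T u₀ - ⟪u₀, T u₀⟫_ℂ • u₀‖ * ‖g‖ * ‖a‖ :=
    calc ‖⟪adjoint (V T hT (yStart u₀)) (adjoint T (adjoint T g)), L (L a)⟫_ℂ‖
        ≤ ‖adjoint (V T hT (yStart u₀)) (adjoint T (adjoint T g))‖ * ‖L (L a)‖ := norm_inner_le_norm _ _
      _ ≤ (1.76 * ‖T‖ * ‖T u₀ - ⟪u₀, T u₀⟫_ℂ • u₀‖ * ‖g‖) * ‖a‖ :=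
          mul_le_mul (norm_adjoint_V_tail_le T hT hT10 u₀ g ⟪u₀, T u₀⟫_ℂ hn₀q hgu₀) hLL (norm_nonneg _)
            (by positivity)
  have hmain : ‖a 1‖ * (Real.sqrt 3 / 2) * ‖g‖ ^ 2 ≤
      ‖g‖ * Real.sqrt ‖s‖ + 1.76 * ‖T‖ * ‖T u₀ - ⟪u₀, T u₀⟫_ℂ • u₀‖ * ‖g‖ * ‖a‖ := by
    have h1 : ‖(a 1 : ℂ) * (((Real.sqrt 3 / 2 : ℝ) : ℂ) * ((‖g‖ ^ 2 : ℝ) : ℂ))‖ =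
        ‖a 1‖ * (Real.sqrt 3 / 2) * ‖g‖ ^ 2 := by
      rw [norm_mul, norm_mul, Complex.norm_real, Complex.norm_real, Real.norm_of_nonneg hc₀.le,
        Real.norm_of_nonneg (sq_nonneg _)]; ring
    have e : (a 1 : ℂ) * (((Real.sqrt 3 / 2 : ℝ) : ℂ) * ((‖g‖ ^ 2 : ℝ) : ℂ)) =
        -⟪g, xStart u₀ u₁ - V T hT (yStart u₀) a⟫_ℂ -
          ⟪adjoint (V T hT (yStart u₀)) (adjoint T (adjoint T g)), L (L a)⟫_ℂ := by
      rw [hgz]; ring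
    have h2 : ‖(a 1 : ℂ) * (((Real.sqrt 3 / 2 : ℝ) : ℂ) * ((‖g‖ ^ 2 : ℝ) : ℂ))‖ ≤
        ‖⟪g, xStart u₀ u₁ - V T hT (yStart u₀) a⟫_ℂ‖ +
          ‖⟪adjoint (V T hT (yStart u₀)) (adjoint T (adjoint T g)), L (L a)⟫_ℂ‖ := by
      rw [e]; exact (norm_sub_le _ _).trans (by rw [norm_neg])
    rw [← h1]
    linarith only [h2, hgz_le, htail]
  -- (iii) eliminate `|a₁|`: divide by `‖g‖`, then multiply by `|m₁| ≤ η`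
  have hdiv : ‖a 1‖ * (Real.sqrt 3 / 2) * ‖g‖ ≤
      Real.sqrt ‖s‖ + 1.76 * ‖T‖ * ‖T u₀ - ⟪u₀, T u₀⟫_ℂ • u₀‖ * ‖a‖ := by
    rcases hg0.eq_or_lt with h0 | hpos
    · rw [← h0, mul_zero]; positivity
    · refine le_of_mul_le_mul_left ?_ hpos
      nlinarith only [hmain]
  have hsS : ‖s‖ ≤ (Real.sqrt 3 / 2 + 0.872 * ‖T‖) * η * ‖a‖ := by
    have h1 : Real.sqrt 3 / 2 * ‖a 1‖ * ‖⟪u₁, T u₀⟫_ℂ‖ ≤ Real.sqrt 3 / 2 * ‖a‖ * η :=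
      mul_le_mul (mul_le_mul_of_nonneg_left ha1 hc₀.le) hm₁η (norm_nonneg _) (by positivity)
    nlinarith only [hs_le, h1]
  have hcomb : (w - 0.872 * ‖T‖ * η * ‖a‖) * ‖g‖ ≤
      ‖⟪u₁, T u₀⟫_ℂ‖ * (‖a 1‖ * (Real.sqrt 3 / 2) * ‖g‖) := by
    have h1 : w - 0.872 * ‖T‖ * η * ‖a‖ ≤ Real.sqrt 3 / 2 * ‖a 1‖ * ‖⟪u₁, T u₀⟫_ℂ‖ := by
      linarith only [hws, hs_le]
    have h2 := mul_le_mul_of_nonneg_right h1 hg0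
    nlinarith only [h2]
  have hsqrt := Real.sqrt_le_sqrt hsS
  calc (w - 0.872 * ‖T‖ * η * ‖a‖) * ‖g‖ ≤ ‖⟪u₁, T u₀⟫_ℂ‖ * (‖a 1‖ * (Real.sqrt 3 / 2) * ‖g‖) := hcomb
    _ ≤ η * (Real.sqrt ((Real.sqrt 3 / 2 + 0.872 * ‖T‖) * η * ‖a‖) +
        1.76 * ‖T‖ * ‖T u₀ - ⟪u₀, T u₀⟫_ℂ • u₀‖ * ‖a‖) :=
        mul_le_mul hm₁η (hdiv.trans (add_le_add hsqrt le_rfl)) (by positivity) hη0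

/-! ### The growth half of Lemma 1, on its own -/

/-- **The growth half of the proof of Lemma 1** (v2 p.9 l.1–6, with the sharp step (10) `Lemma1.step_radius`): if
`0 < t ≤ 1/100` and EVERY minimiser `ℓ'_ε`, `ε ∈ [½ − 2t, ½]`, has `εθ(ℓ'_ε) > t`, then along the grid
`ε_k = ½ − kδt` (`δ = 2/⌈2/t⌉`) minimisers exist with `‖ℓ'_{ε_k}‖ ≤ (1+δ)^k`, so `ℓ'_{½−2t}` exists and
`‖ℓ'_{½−2t}‖ ≤ e² < 7.39`.  (Extracted verbatim from the proof of `Lemma1.lemma1_repaired`.) [cite: Enflo2023, v2 p.9, l.1–6] -/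
theorem exists_minimal_of_forall_lt (T : H →L[ℂ] H) (hT : ‖T‖ < 1) (u₀ u₁ : H)
    (hu₀ : ‖u₀‖ = 1) (hu₁ : ‖u₁‖ = 1) (h01 : ⟪u₀, u₁⟫_ℂ = 0) {t : ℝ} (ht0 : 0 < t) (ht1 : t ≤ 1 / 100)
    (hcon : ∀ (ε : ℝ) (a : ℓ2), 1 / 2 - 2 * t ≤ ε → ε ≤ 1 / 2 →
      IsMinimal (V T hT (yStart u₀)) (xStart u₀ u₁) ε a →
      t < (⟪xStart u₀ u₁ - V T hT (yStart u₀) a, V T hT (yStart u₀) a⟫_ℂ).re) :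
    ∃ a : ℓ2, IsMinimal (V T hT (yStart u₀)) (xStart u₀ u₁) (1 / 2 - 2 * t) a ∧ ‖a‖ ≤ 7.39 := by
  set x₀ := xStart u₀ u₁ with hx₀def
  set y := yStart u₀ with hydef
  have hx1 : ‖x₀‖ = 1 := norm_xStart u₀ u₁ hu₀ hu₁ h01
  set n : ℕ := ⌈2 / t⌉₊ with hndef
  have hn2 : 2 / t ≤ (n : ℝ) := Nat.le_ceil _
  have hnpos : (0 : ℝ) < n := lt_of_lt_of_le (by positivity) hn2
  set δ : ℝ := 2 / n with hδdef
  have hδ0 : 0 < δ := by positivity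
  have hδt : δ ≤ t := by
    rw [hδdef, div_le_iff₀ hnpos]
    have := (div_le_iff₀ ht0).1 hn2
    linarith
  have hnδ : (n : ℝ) * δ = 2 := by rw [hδdef]; field_simp
  set r : ℕ → ℝ := fun k => 1 / 2 - (k : ℝ) * (δ * t) with hrdef
  have hr0 : r 0 = 1 / 2 := by simp [hrdef]
  have hrS : ∀ k, r (k + 1) = r k - δ * t := by intro k; simp only [hrdef]; push_cast; ring
  have hrn : r n = 1 / 2 - 2 * t := by
    simp only [hrdef]; rw [← mul_assoc, hnδ]
  have hrlo : ∀ k, k ≤ n → 1 / 2 - 2 * t ≤ r k := by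
    intro k hk
    have hk' : (k : ℝ) ≤ n := by exact_mod_cast hk
    have h1 : (k : ℝ) * (δ * t) ≤ (n : ℝ) * (δ * t) :=
      mul_le_mul_of_nonneg_right hk' (by positivity)
    have h2 : (n : ℝ) * (δ * t) = 2 * t := by rw [← mul_assoc, hnδ]
    show 1 / 2 - 2 * t ≤ 1 / 2 - (k : ℝ) * (δ * t)
    linarith
  have hrhi : ∀ k, r k ≤ 1 / 2 := by
    intro k; simp only [hrdef]
    have : 0 ≤ (k : ℝ) * (δ * t) := by positivity
    linarith
  have key : ∀ k, k ≤ n → ∃ a : ℓ2, IsMinimal (V T hT y) x₀ (r k) a ∧ ‖a‖ ≤ (1 + δ) ^ k := by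
    intro k
    induction k with
    | zero =>
      intro _
      have hfe : ‖x₀ - y‖ ≤ r 0 := by rw [hr0, hx₀def, hydef, norm_xStart_sub_yStart u₀ u₁ hu₁]
      have h1 : ∀ z : H, (1 : H →L[ℂ] H) z = z := fun z => rfl
      have hfeas : lp.single 2 0 (1 : ℂ) ∈ feasible (V T hT y) x₀ (r 0) := by
        show ‖x₀ - V T hT y (lp.single 2 0 (1 : ℂ))‖ ≤ r 0
        rw [V_single, pow_zero, h1]; exact hfe
      obtain ⟨a, ha⟩ := exists_isMinimal (V T hT y) x₀ (r 0) ⟨_, hfeas⟩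
      exact ⟨a, ha, by rw [pow_zero]; exact norm_minimal_le_one T hT y x₀ (r 0) a ha hfe⟩
    | succ k ih =>
      intro hk
      have hkn : k ≤ n := Nat.le_of_succ_le hk
      obtain ⟨a, ha, hna⟩ := ih hkn
      have hlt : t < (⟪x₀ - V T hT y a, V T hT y a⟫_ℂ).re := hcon (r k) a (hrlo k hkn) (hrhi k) ha
      have hane : a ≠ 0 := ha.ne_zero (by rw [hx1]; linarith [hrhi k])
      obtain ⟨C, hC0, hC⟩ := ha.kkt hane
      have hθ0 : 0 ≤ (⟪x₀ - V T hT y a, V T hT y a⟫_ℂ).re := IsMinimal.etheta_nonneg hC0 hC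
      have hV1 : ‖V T hT y a‖ ≤ 1 := norm_move_le_one x₀ _ hx1 hθ0
      have hδε : δ * t ≤ r k := by
        have h1 : δ * t ≤ t * t := mul_le_mul_of_nonneg_right hδt ht0.le
        have h2 := hrlo k hkn
        nlinarith
      have hstep : ‖x₀ - ((1 + δ : ℝ) : ℂ) • V T hT y a‖ ≤ r k - δ * t :=
        step_radius x₀ (V T hT y a) hV1 ha.norm_sub_le hlt.le hδ0.le hδt (hrhi k) hδε
      have hfe' : ((1 + δ : ℝ) : ℂ) • a ∈ feasible (V T hT y) x₀ (r (k + 1)) := by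
        show ‖x₀ - V T hT y (((1 + δ : ℝ) : ℂ) • a)‖ ≤ r (k + 1)
        rw [map_smul, hrS]; exact hstep
      obtain ⟨b, hb⟩ := exists_isMinimal (V T hT y) x₀ (r (k + 1)) ⟨_, hfe'⟩
      refine ⟨b, hb, ?_⟩
      have hδ1 : 0 ≤ 1 + δ := by linarith
      calc ‖b‖ ≤ ‖((1 + δ : ℝ) : ℂ) • a‖ := hb.norm_le hfe'
        _ = (1 + δ) * ‖a‖ := by rw [norm_smul, Complex.norm_real, Real.norm_of_nonneg hδ1]
        _ ≤ (1 + δ) * (1 + δ) ^ k := mul_le_mul_of_nonneg_left hna hδ1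
        _ = (1 + δ) ^ (k + 1) := by ring
  obtain ⟨a, ha, hna⟩ := key n le_rfl
  have hup : ‖a‖ ≤ 7.39 := by
    have h1 := growth_le hδ0.le n
    rw [hnδ] at h1
    have he : Real.exp 2 < 7.39 := by
      have h4 := Real.exp_one_lt_d9
      have h3 : Real.exp 2 = Real.exp 1 ^ 2 := by rw [← Real.exp_nat_mul]; norm_num
      rw [h3]; nlinarith [Real.exp_pos 1]
    linarith
  rw [hrn] at ha
  exact ⟨a, ha, hup⟩

/-! ### The printed Lemma 1 in the manuscript's order of quantifiers -/

/-- **The arithmetic endgame** of `lemma1_printed_of_defect`, over the reals: `q = ‖T‖ ≤ 10⁻²⁰`, `σ = σ₀ ≤ 10⁻²⁰`,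
`(εθ)₀·10¹¹ ≤ σ²`, `A = ‖ℓ'‖ ≤ 7.39`, `G = ‖g‖ ≥ 0.999σ`, `S = √((√3/2 + 0.872q)(εθ)₀A)`; then the inequality of
`Defect.feasible_defect_ineq` with `w = 10⁻⁵(εθ)₀`, `η = (εθ)₀` is impossible (`9.98·10⁻⁶(εθ)₀σ ≤ 8.01·10⁻⁶(εθ)₀σ`).
[folklore] -/
lemma defect_numerics {e₀ σ q A G S : ℝ} (he : 0 < e₀) (hσ0 : 0 ≤ σ) (hq : q ≤ 1 / 10 ^ 20)
    (hσq : σ ≤ 1 / 10 ^ 20) (hdef : e₀ * 10 ^ 11 ≤ σ ^ 2) (hA0 : 0 ≤ A) (hA : A ≤ 7.39)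
    (hG : 0.999 * σ ≤ G) (hS : S ^ 2 ≤ (Real.sqrt 3 / 2 + 0.872 * q) * e₀ * A)
    (hineq : (e₀ / 10 ^ 5 - 0.872 * q * e₀ * A) * G ≤ e₀ * (S + 1.76 * q * σ * A)) : False := by
  have hc := sqrt3_half_bounds.2
  have hσσ : σ ^ 2 ≤ σ * (1 / 10 ^ 20) := by rw [sq]; exact mul_le_mul_of_nonneg_left hσq hσ0
  have he1 : e₀ * 10 ^ 31 ≤ σ := by nlinarith only [hdef, hσσ]
  have hσpos : 0 < σ := by nlinarith only [he, he1]
  have heσ : 0 ≤ e₀ * σ := mul_nonneg he.le hσ0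
  -- `S ≤ 8.0063·10⁻⁶σ`
  have hS1 : S ^ 2 ≤ 6.4005 * e₀ := by
    have h1 : Real.sqrt 3 / 2 + 0.872 * q ≤ 0.8661 := by nlinarith only [hc, hq]
    have h3 : (Real.sqrt 3 / 2 + 0.872 * q) * e₀ ≤ 0.8661 * e₀ := mul_le_mul_of_nonneg_right h1 he.le
    have h2 : (Real.sqrt 3 / 2 + 0.872 * q) * e₀ * A ≤ 0.8661 * e₀ * 7.39 :=
      mul_le_mul h3 hA hA0 (mul_nonneg (by norm_num) he.le)
    nlinarith only [hS, h2]
  have hS2 : S ≤ 8.0063 / 10 ^ 6 * σ := by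
    have h1 : S ^ 2 ≤ (8.0063 / 10 ^ 6 * σ) ^ 2 := by nlinarith only [hS1, hdef]
    exact le_of_pow_le_pow_left₀ two_ne_zero (mul_nonneg (by norm_num) hσ0) h1
  have hqA : q * A ≤ 1 / 10 ^ 20 * 7.39 := mul_le_mul hq hA hA0 (by norm_num)
  -- the right-hand side is `≤ 8.0064·10⁻⁶ (εθ)₀ σ`
  have hR : S + 1.76 * q * σ * A ≤ 8.0064 / 10 ^ 6 * σ := by
    have h1 : 1.76 * q * σ * A ≤ 1.76 * (1 / 10 ^ 20 * 7.39) * σ := by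
      have h := mul_le_mul_of_nonneg_left hqA (mul_nonneg (by norm_num : (0:ℝ) ≤ 1.76) hσ0)
      nlinarith only [h]
    nlinarith only [hS2, h1, hσ0]
  -- the left-hand side is `≥ 9.989·10⁻⁶ (εθ)₀ σ`
  have hL : e₀ * (9.989 / 10 ^ 6 * σ) ≤ (e₀ / 10 ^ 5 - 0.872 * q * e₀ * A) * G := by
    have h1 : 0.872 * q * e₀ * A ≤ 0.872 * (1 / 10 ^ 20 * 7.39) * e₀ := by
      have h := mul_le_mul_of_nonneg_left hqA (mul_nonneg (by norm_num : (0:ℝ) ≤ 0.872) he.le)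
      nlinarith only [h]
    have h2 : e₀ * (0.99999 / 10 ^ 5) ≤ e₀ / 10 ^ 5 - 0.872 * q * e₀ * A := by nlinarith only [h1, he]
    have h3 : e₀ * (0.99999 / 10 ^ 5) * (0.999 * σ) ≤ (e₀ / 10 ^ 5 - 0.872 * q * e₀ * A) * G :=
      mul_le_mul h2 hG (mul_nonneg (by norm_num) hσ0) (by nlinarith only [h2, he])
    nlinarith only [h3, heσ]
  have hfin : e₀ * (9.989 / 10 ^ 6 * σ) ≤ e₀ * (8.0064 / 10 ^ 6 * σ) :=
    hL.trans (hineq.trans (mul_le_mul_of_nonneg_left hR he.le))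
  nlinarith only [hfin, mul_pos he hσpos]

end Defect

/-- **Printed Lemma 1 holds once `(εθ)₀ ≤ 10⁻¹¹σ₀²` — with the PRINTED choice of `u₁`.**  Let `‖T‖ ≤ 10⁻²⁰`, `u₀ ⟂ u₁`
unit vectors, `σ₀ = ‖Tu₀ − ⟨u₀,Tu₀⟩u₀‖` the eigen-defect of `u₀`, `0 < (εθ)₀ ≤ 10⁻¹¹σ₀²`, and `‖T*u₁‖ ≤ (εθ)₀`
(p. 7).  Then some `ε ∈ [½ − 10⁻⁵(εθ)₀, ½]` carries a minimiser `ℓ'_ε` with `εθ(ℓ'_ε) ≤ ½·10⁻⁵(εθ)₀` (the printed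
conclusion, pp. 8–9).  Proof: otherwise `Defect.exists_minimal_of_forall_lt` gives `ℓ'_{½−10⁻⁵(εθ)₀}` with norm
`≤ 7.39`, and `Defect.feasible_defect_ineq` (`w = 10⁻⁵(εθ)₀`, `η = (εθ)₀`) forces
`0.999·10⁻⁵σ₀ ≲ 2.53√(εθ)₀ + 1.4·10⁻¹⁹σ₀`, i.e. `(εθ)₀ ≳ 1.5·10⁻¹¹σ₀²` (`Defect.defect_numerics`).  In the
counter-models of `Lemma1Model` … `Lemma1Cyclic` one has `(εθ)₀ ≍ σ₀` instead.
[cite: Enflo2023, v2 p.7 (choice of u₁), p.8, pp.8–9 Lemma 1] -/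
theorem lemma1_printed_of_defect (T : H →L[ℂ] H) (hT : ‖T‖ < 1) (hT20 : ‖T‖ ≤ 1 / 10 ^ 20) (u₀ u₁ : H)
    (hu₀ : ‖u₀‖ = 1) (hu₁ : ‖u₁‖ = 1) (h01 : ⟪u₀, u₁⟫_ℂ = 0) {e₀ : ℝ} (he : 0 < e₀)
    (hdef : e₀ ≤ ‖T u₀ - ⟪u₀, T u₀⟫_ℂ • u₀‖ ^ 2 / 10 ^ 11) (hadj : ‖adjoint T u₁‖ ≤ e₀) :
    ∃ (ε : ℝ) (a : ℓ2), 1 / 2 - e₀ / 10 ^ 5 ≤ ε ∧ ε ≤ 1 / 2 ∧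
      IsMinimal (V T hT (yStart u₀)) (xStart u₀ u₁) ε a ∧
      (⟪xStart u₀ u₁ - V T hT (yStart u₀) a, V T hT (yStart u₀) a⟫_ℂ).re ≤ e₀ / (2 * 10 ^ 5) := by
  have hT10 : ‖T‖ ≤ 1 / 10 := hT20.trans (by norm_num)
  obtain ⟨σ, hσ⟩ : ∃ σ : ℝ, σ = ‖T u₀ - ⟪u₀, T u₀⟫_ℂ • u₀‖ := ⟨_, rfl⟩
  rw [← hσ] at hdef
  have hσ0 : 0 ≤ σ := by rw [hσ]; exact norm_nonneg _
  have hσ20 : σ ≤ 1 / 10 ^ 20 := by rw [hσ]; exact (Defect.defect_le_opNorm T u₀ hu₀).trans hT20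
  have hdef' : e₀ * 10 ^ 11 ≤ σ ^ 2 := (le_div_iff₀ (by positivity)).1 hdef
  have hσσ : σ ^ 2 ≤ σ * (1 / 10 ^ 20) := by rw [sq]; exact mul_le_mul_of_nonneg_left hσ20 hσ0
  have he2 : e₀ ≤ 1 / 10 ^ 51 := by nlinarith only [hdef', hσσ, hσ20]
  have ht0 : 0 < e₀ / (2 * 10 ^ 5) := div_pos he (by norm_num)
  have ht1 : e₀ / (2 * 10 ^ 5) ≤ 1 / 100 := by
    rw [div_le_iff₀ (by norm_num)]; nlinarith only [he2]
  have h2t : 2 * (e₀ / (2 * 10 ^ 5)) = e₀ / 10 ^ 5 := by ring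
  by_contra hcon
  push Not at hcon
  have hcon' : ∀ (ε : ℝ) (b : ℓ2), 1 / 2 - 2 * (e₀ / (2 * 10 ^ 5)) ≤ ε → ε ≤ 1 / 2 →
      IsMinimal (V T hT (yStart u₀)) (xStart u₀ u₁) ε b →
      e₀ / (2 * 10 ^ 5) < (⟪xStart u₀ u₁ - V T hT (yStart u₀) b, V T hT (yStart u₀) b⟫_ℂ).re := by
    intro ε b h1 h2 h3
    rw [h2t] at h1
    exact hcon ε b h1 h2 h3
  obtain ⟨a, ha, hA⟩ := Defect.exists_minimal_of_forall_lt T hT u₀ u₁ hu₀ hu₁ h01 ht0 ht1 hcon'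
  have hfe : ‖xStart u₀ u₁ - V T hT (yStart u₀) a‖ ≤ 1 / 2 - e₀ / 10 ^ 5 := by
    have h := ha.norm_sub_le; rwa [h2t] at h
  have hw0 : 0 ≤ e₀ / 10 ^ 5 := (div_pos he (by norm_num)).le
  have hw1 : e₀ / 10 ^ 5 ≤ 1 := by rw [div_le_iff₀ (by norm_num)]; nlinarith only [he2]
  have hineq := Defect.feasible_defect_ineq T hT hT10 u₀ u₁ hu₀ hu₁ h01 a hw0 hw1 hadj hfe
  obtain ⟨G, hG⟩ : ∃ G : ℝ, G = ‖T u₀ - ⟪u₀, T u₀⟫_ℂ • u₀ - ⟪u₁, T u₀⟫_ℂ • u₁‖ := ⟨_, rfl⟩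
  rw [← hG, ← hσ] at hineq
  have hG0 : 0 ≤ G := by rw [hG]; exact norm_nonneg _
  -- the garbage vector has norm `≥ 0.999σ`
  have hm₁ : ‖⟪u₁, T u₀⟫_ℂ‖ ≤ e₀ := by
    calc ‖⟪u₁, T u₀⟫_ℂ‖ = ‖⟪adjoint T u₁, u₀⟫_ℂ‖ := by rw [adjoint_inner_left]
      _ ≤ ‖adjoint T u₁‖ * ‖u₀‖ := norm_inner_le_norm _ _
      _ ≤ e₀ := by rw [hu₀, mul_one]; exact hadj
  have hGσ : 0.999 * σ ≤ G := by
    have h1 := Defect.norm_sq_garbage T u₀ u₁ hu₁ h01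
    rw [← hG, ← hσ] at h1
    have h2 : ‖⟪u₁, T u₀⟫_ℂ‖ ^ 2 ≤ e₀ ^ 2 := pow_le_pow_left₀ (norm_nonneg _) hm₁ 2
    have he1 : e₀ * 10 ^ 31 ≤ σ := by nlinarith only [hdef', hσσ]
    have he1sq : (e₀ * 10 ^ 31) ^ 2 ≤ σ ^ 2 := pow_le_pow_left₀ (mul_nonneg he.le (by norm_num)) he1 2
    have h3 : (0.999 * σ) ^ 2 ≤ G ^ 2 := by rw [h1]; nlinarith only [h2, he1sq]
    exact le_of_pow_le_pow_left₀ two_ne_zero hG0 h3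
  have hrad0 : 0 ≤ (Real.sqrt 3 / 2 + 0.872 * ‖T‖) * e₀ * ‖a‖ :=
    mul_nonneg (mul_nonneg (by positivity) he.le) (norm_nonneg _)
  exact Defect.defect_numerics he hσ0 hT20 hσ20 hdef' (norm_nonneg a) hA hGσ (Real.sq_sqrt hrad0).le hineq

/-- **The manuscript's order of quantifiers** (v2 p.7, tex L255–L265: `T` and the Type-1 vector `u₀` first, then
"`(εθ)₀` chosen below", then `u₁`).  For EVERY `T` with `‖T‖ ≤ 10⁻²⁰` and EVERY unit `u₀`: every
`(εθ)₀ ∈ (0, 10⁻¹¹σ₀²]` and every admissible `u₁` (unit, `⟂ u₀`, printed requirement `‖T*u₁‖ < (εθ)₀`) satisfy the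
printed conclusion of Lemma 1.  So "(εθ)₀ small" in the sense `(εθ)₀ ≤ 10⁻¹¹‖Tu₀ − ⟨u₀,Tu₀⟩u₀‖²` repairs (24) / the
choice of `u₁` without changing the choice (`σ₀ = 0` means `u₀` is an eigenvector of `T`: excluded for the operators
of p.1 only implicitly, and then the invariant-subspace question for `T` is trivial anyway). [cite: Enflo2023, v2 p.7 (choice of u₁), p.8, pp.8–9 Lemma 1] -/
theorem lemma1_printed_forall_u1 (T : H →L[ℂ] H) (hT : ‖T‖ < 1) (hT20 : ‖T‖ ≤ 1 / 10 ^ 20) (u₀ : H)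
    (hu₀ : ‖u₀‖ = 1) :
    ∀ e₀ : ℝ, 0 < e₀ → e₀ ≤ ‖T u₀ - ⟪u₀, T u₀⟫_ℂ • u₀‖ ^ 2 / 10 ^ 11 →
      ∀ u₁ : H, ‖u₁‖ = 1 → ⟪u₀, u₁⟫_ℂ = 0 → ‖adjoint T u₁‖ < e₀ →
        ∃ (ε : ℝ) (a : ℓ2), 1 / 2 - e₀ / 10 ^ 5 ≤ ε ∧ ε ≤ 1 / 2 ∧
          IsMinimal (V T hT (yStart u₀)) (xStart u₀ u₁) ε a ∧
          (⟪xStart u₀ u₁ - V T hT (yStart u₀) a, V T hT (yStart u₀) a⟫_ℂ).re ≤ e₀ / (2 * 10 ^ 5) :=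
  fun _ he hdef u₁ hu₁ h01 hadj => lemma1_printed_of_defect T hT hT20 u₀ u₁ hu₀ hu₁ h01 he hdef hadj.le

/-! ### Both phenomena on the same data: `T = D_c`, `u₀ = ρ` -/

namespace Cyclic

open CaseII.ModelC (Dc norm_Dc norm_Dc_le norm_Dc_lt_one Dc_isSelfAdjoint Dc_injective Dc_denseRange
  Dc_not_surjective zero_mem_spectrum_Dc)
open CaseII.WindowModelT (lam lam_def)

/-- The eigen-defect of `ρ` for `D_c` is exactly `σ = ‖g‖/‖z‖` (`D_c ρ = x̄ρ + σu₁`, `u₁ ⟂ ρ`), hence `≥ (εθ)₀/4` at the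
scale `(εθ)₀ = 2·10⁻²⁰a` of the construction (`Lemma1.Cyclic.lever_ge`). [folklore] -/
lemma defect_rho_ge {a : ℝ} (ha : 0 < a) (ha1 : a ≤ 1 / 400) {K : ℕ} (hK : 1 ≤ K)
    (hKa : 1 / ((K : ℝ) + 1) ≤ a ^ 2) :
    2 * lam * a / 4 ≤ ‖Dc (rho a K) - ⟪rho a K, Dc (rho a K)⟫_ℂ • rho a K‖ := by
  have hD := Dc_rho ha ha1 hK hKa
  have h00 : ⟪rho a K, rho a K⟫_ℂ = 1 := by rw [inner_self_eq_norm_sq_to_K, norm_rho a hK]; norm_num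
  have hin : ⟪rho a K, Dc (rho a K)⟫_ℂ = ((xbar a K : ℝ) : ℂ) := by
    rw [hD, inner_add_right, inner_smul_right, inner_smul_right, h00, inner_rho_u1 a hK, mul_one, mul_zero, add_zero]
  have hdef : Dc (rho a K) - ⟪rho a K, Dc (rho a K)⟫_ℂ • rho a K = ((‖zv a K‖⁻¹ * ‖gv a K‖ : ℝ) : ℂ) • u1 a K := by
    rw [hin, hD]; abel
  rw [hdef, norm_smul, Complex.norm_real, Real.norm_of_nonneg (by positivity), norm_u1 ha ha1 hK hKa, mul_one]
  have := lever_ge ha ha1 hK hKa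
  linarith

/-- **The order-of-quantifiers dichotomy on ONE data set** (`T = D_c = diag(10⁻²⁰/(k+1))` on `ℓ²(ℕ)`: standing form
of v2 p.1, self-adjoint; `u₀ = ρ` the cyclic Type-1 vector of `Lemma1Cyclic` built at scale `e₁`).  For every
`e₁ ∈ (0, 5·10⁻²³]`: (i) with `(εθ)₀ = e₁` and the `u₁` of `Lemma1Cyclic` (printed requirement `‖T*u₁‖ < e₁` holds)
the printed conclusion of Lemma 1 FAILS at every radius of `(½ − 10⁻⁵e₁, ½]`; (ii) for the SAME `T, u₀`, every
`(εθ)₀ ∈ (0, 6·10⁻¹³e₁²]` and EVERY admissible `u₁'` (unit, `⟂ u₀`, `‖T*u₁'‖ ≤ (εθ)₀`) satisfy the printed conclusion.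
So failure of the printed choice of `u₁` requires `(εθ)₀` comparable to the eigen-defect of `u₀` (`(εθ)₀ = e₁ ≤ 4σ₀`
here); once `(εθ)₀` is chosen after `u₀` and small (`≪ σ₀²`), as on p.7/p.8, it cannot occur. [cite: Enflo2023, v2 p.1, p.7 (choice of u₁), p.8, pp.8–9 Lemma 1] -/
theorem printed_lemma1_order_dichotomy (e₁ : ℝ) (he : 0 < e₁) (he1 : e₁ ≤ 1 / (2 * 10 ^ 22)) :
    ∃ (u₀ u₁ : ℓ2) (hT : ‖Dc‖ < 1),
      ‖Dc‖ = 1 / 10 ^ 20 ∧ Function.Injective Dc ∧ DenseRange Dc ∧ ¬ Function.Surjective Dc ∧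
      IsSelfAdjoint Dc ∧ ‖u₀‖ = 1 ∧ ‖u₁‖ = 1 ∧ ⟪u₀, u₁⟫_ℂ = 0 ∧ Referee.Type1 Dc ∧
      e₁ / 4 ≤ ‖Dc u₀ - ⟪u₀, Dc u₀⟫_ℂ • u₀‖ ∧
      ‖adjoint Dc u₁‖ < e₁ ∧
      (∀ (ε : ℝ) (b : ℓ2), 1 / 2 - e₁ / 10 ^ 5 < ε → ε ≤ 1 / 2 →
        IsMinimal (V Dc hT (yStart u₀)) (xStart u₀ u₁) ε b →
        e₁ / (2 * 10 ^ 5) < (⟪xStart u₀ u₁ - V Dc hT (yStart u₀) b, V Dc hT (yStart u₀) b⟫_ℂ).re) ∧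
      (∀ e₀ : ℝ, 0 < e₀ → e₀ ≤ 6 / 10 ^ 13 * e₁ ^ 2 →
        ∀ u₁' : ℓ2, ‖u₁'‖ = 1 → ⟪u₀, u₁'⟫_ℂ = 0 → ‖adjoint Dc u₁'‖ ≤ e₀ →
          ∃ (ε : ℝ) (b : ℓ2), 1 / 2 - e₀ / 10 ^ 5 ≤ ε ∧ ε ≤ 1 / 2 ∧
            IsMinimal (V Dc hT (yStart u₀)) (xStart u₀ u₁') ε b ∧
            (⟪xStart u₀ u₁' - V Dc hT (yStart u₀) b, V Dc hT (yStart u₀) b⟫_ℂ).re ≤ e₀ / (2 * 10 ^ 5)) := by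
  set a : ℝ := e₁ * 10 ^ 20 / 2 with ha_def
  have ha : 0 < a := by positivity
  have ha1 : a ≤ 1 / 400 := by
    rw [ha_def, div_le_iff₀ (by norm_num : (0:ℝ) < 2)]
    have := mul_le_mul_of_nonneg_right he1 (by norm_num : (0:ℝ) ≤ 10 ^ 20)
    norm_num at this ⊢
    linarith
  have hK := one_le_Kof ha
  have hKa := inv_Kof_succ_le ha
  have hae : 2 * lam * a = e₁ := by rw [lam_def, ha_def]; ring
  obtain ⟨hadj, hfail⟩ := printed_lemma1_fails_param ha ha1 hK hKa norm_Dc_lt_one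
  have hdef := defect_rho_ge ha ha1 hK hKa
  rw [hae] at hadj hfail hdef
  refine ⟨rho a (Kof a), u1 a (Kof a), norm_Dc_lt_one, norm_Dc, Dc_injective, Dc_denseRange, Dc_not_surjective,
    Dc_isSelfAdjoint, norm_rho a hK, norm_u1 ha ha1 hK hKa, inner_rho_u1 a hK, type1_via_rho ha ha1 hK, hdef, hadj,
    hfail, fun e₀ he0 he0' u₁' hu₁' h01' hadj' => ?_⟩
  refine lemma1_printed_of_defect Dc norm_Dc_lt_one norm_Dc_le (rho a (Kof a)) u₁' (norm_rho a hK) hu₁' h01' he0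
    ?_ hadj'
  have h1 : (e₁ / 4) ^ 2 ≤ ‖Dc (rho a (Kof a)) - ⟪rho a (Kof a), Dc (rho a (Kof a))⟫_ℂ • rho a (Kof a)‖ ^ 2 :=
    pow_le_pow_left₀ (by positivity) hdef 2
  have h2 : 6 / 10 ^ 13 * e₁ ^ 2 ≤ (e₁ / 4) ^ 2 / 10 ^ 11 := by
    rw [le_div_iff₀ (by positivity)]; nlinarith [sq_nonneg e₁]
  calc e₀ ≤ 6 / 10 ^ 13 * e₁ ^ 2 := he0'
    _ ≤ (e₁ / 4) ^ 2 / 10 ^ 11 := h2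
    _ ≤ _ := by gcongr

end Cyclic

end Lemma1

end Literature.Analysis.OperatorTheory.Enflo2023

end
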